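import Summits.KontsevichZagierPeriods.KontsevichZagierPeriods.Theorems.LiouvilleUnfoldingLogKernelConjectureIffSummit
import Summits.KontsevichZagierPeriods.KontsevichZagierPeriods.Theorems.VietaFibreKernelFormItemDictionary

/-!
# `LogKernelConjectureSplitGlue` (stmt-KontsevichZagierPeriods-17107): the `[π]`-split of the crux
# `LogKernelConjecture` glues

Route LiouvilleUnfolding, support item 17107 (the strategist's decomposition of the crux
`LogKernelConjecture`, stmt-2837, along `[π]`). The item is the GLUE implication

  ⟨body of `AyoubPiLocalKernel` (stmt-0541)⟩ → ⟨body of `AyoubPiCancellation` (stmt-0540)⟩ →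
    `LogKernelConjecture`,

with both antecedents typed by the literal statements of the two existing items of route
AyoubSpecialisation (every formal combination of value `0` becomes a relation after enough
multiplications by a pinned product `P n r = [unit disc] ⋆ r`; and `P`-multiplication reflects
relations).

Proof (unconditional, nothing re-proved): `LogKernelConjecture ↔ KZKernelConjecture`
(`SpectatorLocalisation.logKernelConjecture_iff_kzKernelConjecture`, because the logarithmic
Newton–Leibniz rule is a derived move) and `VietaFibre.KernelForm ↔ AyoubPiLocalKernel ∧
AyoubPiCancellation` (`KernelForm.LocaliseAtValuePrime.kernelForm_iff_ayoubPiLocalKernel_and_ayoubPiCancellation`),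
where `VietaFibre.KernelForm` is `KZKernelConjecture` and `AyoubSpecialisation.AyoubPiLocalKernel`,
`AyoubSpecialisation.AyoubPiCancellation` are the two antecedents, all on the nose (definitional
unfolding). We also record the exactness of the split (`↔`), so that neither child is the crux
weakened for free. Adapted from the planner's `Cruxes/LogKernelConjecture/StrategistSplit.lean`.

References: M. Kontsevich, D. Zagier, *Periods* (2001), §1.2 Conjecture 1, §4.1
(`P̂ = P[(2πi)⁻¹]`); J. Ayoub, *Periods and the conjectures of Grothendieck and Kontsevich–Zagier*,
EMS Newsl. 91 (2014), Def. 6 / Conj. 7; A. Huber, G. Wüstholz, *Transcendence and linear relations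
of 1-periods* (2022), App. A.3–A.4.
-/

noncomputable section

namespace Summit.KontsevichZagierPeriods.LiouvilleUnfolding.SplitGlue

open Literature.NumberTheory.Transcendental
open Summit.KontsevichZagierPeriods.KontsevichZagierPeriods.Theses

/-- The two filed items, by name, decide the crux and conversely (exactness of the split):
`LogKernelConjecture ↔ AyoubPiLocalKernel ∧ AyoubPiCancellation` (stmt-2837 ↔ stmt-0541 ∧ stmt-0540).
Composition of `logKernelConjecture_iff_kzKernelConjecture` with
`kernelForm_iff_ayoubPiLocalKernel_and_ayoubPiCancellation` (`VietaFibre.KernelForm` is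
`KZKernelConjecture` definitionally).
[Kontsevich–Zagier 2001, §1.2 Conj. 1, §4.1; Ayoub 2014, Def. 6 / Conj. 7] [folklore] -/
theorem logKernelConjecture_iff_ayoubPiLocalKernel_and_ayoubPiCancellation :
    LiouvilleUnfolding.LogKernelConjecture ↔
      AyoubSpecialisation.AyoubPiLocalKernel ∧ AyoubSpecialisation.AyoubPiCancellation :=
  SpectatorLocalisation.logKernelConjecture_iff_kzKernelConjecture.trans
    (show KZKernelConjecture ↔ _ from
      Summit.KontsevichZagierPeriods.KernelForm.LocaliseAtValuePrime.kernelForm_iff_ayoubPiLocalKernel_and_ayoubPiCancellation)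

/-- **Item stmt-KontsevichZagierPeriods-17107, as filed.** The glue of the strategist's split of the
crux `LogKernelConjecture` along `[π]`, by the literal statements of the children
(`AyoubPiLocalKernel`, stmt-0541, then `AyoubPiCancellation`, stmt-0540): `Sub₁ → Sub₂ → Crux`.
Unconditional. [folklore] -/
theorem logKernelConjectureSplitGlue_proof :
    Summit.KontsevichZagierPeriods.KontsevichZagierPeriods.Theses.LiouvilleUnfolding.LogKernelConjectureSplitGlue := by
  unfold LiouvilleUnfolding.LogKernelConjectureSplitGlue
  intro h₁ h₂
  exact logKernelConjecture_iff_ayoubPiLocalKernel_and_ayoubPiCancellation.2 ⟨h₁, h₂⟩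

/-- **Exactness of the split**, by the literal statements: the crux `LogKernelConjecture` is
equivalent to the conjunction of the two antecedents of `LogKernelConjectureSplitGlue` (so the split
loses nothing and neither child is the crux weakened for free). [folklore] -/
theorem logKernelConjecture_iff_subs :
    LiouvilleUnfolding.LogKernelConjecture ↔
    ((∀ (P : ∀ n : ℕ, Literature.NumberTheory.Transcendental.KZ.IntegralRep n → Literature.NumberTheory.Transcendental.KZ.IntegralRep (n + 2)), (∀ (n : ℕ) (r : Literature.NumberTheory.Transcendental.KZ.IntegralRep n), (P n r).domain = {z : Fin (n + 2) → ℝ | z 0 ^ 2 + z 1 ^ 2 ≤ 1 ∧ (fun i : Fin n => z i.succ.succ) ∈ r.domain} ∧ (P n r).integrand = fun z => r.integrand (fun i : Fin n => z i.succ.succ)) → ∀ c : Literature.NumberTheory.Transcendental.KZ.FormalRep, Literature.NumberTheory.Transcendental.KZ.eval c = 0 → ∃ N : ℕ, (⇑(FreeAbelianGroup.lift (fun s : (Σ n, Literature.NumberTheory.Transcendental.KZ.IntegralRep n) => Literature.NumberTheory.Transcendental.KZ.of (P s.1 s.2))))^[N] c ∈ Literature.NumberTheory.Transcendental.KZ.relations)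 ∧
     (∀ (P : ∀ n : ℕ, Literature.NumberTheory.Transcendental.KZ.IntegralRep n → Literature.NumberTheory.Transcendental.KZ.IntegralRep (n + 2)), (∀ (n : ℕ) (r : Literature.NumberTheory.Transcendental.KZ.IntegralRep n), (P n r).domain = {z : Fin (n + 2) → ℝ | z 0 ^ 2 + z 1 ^ 2 ≤ 1 ∧ (fun i : Fin n => z i.succ.succ) ∈ r.domain} ∧ (P n r).integrand = fun z => r.integrand (fun i : Fin n => z i.succ.succ)) → ∀ c : Literature.NumberTheory.Transcendental.KZ.FormalRep, FreeAbelianGroup.lift (fun s : (Σ n, Literature.NumberTheory.Transcendental.KZ.IntegralRep n) => Literature.NumberTheory.Transcendental.KZ.of (P s.1 s.2)) c ∈ Literature.NumberTheory.Transcendental.KZ.relations → c ∈ Literature.NumberTheory.Transcendental.KZ.relations)) :=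
  logKernelConjecture_iff_ayoubPiLocalKernel_and_ayoubPiCancellation

end Summit.KontsevichZagierPeriods.LiouvilleUnfolding.SplitGlue

end
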